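import Literature.NumberTheory.Automorphic.HilbertRepSchurGraph
import HarnessLib

/-!
# Schur's lemma for closable intertwiners into a representation with the Schur property

Topic `NumberTheory/Automorphic`; sibling of `HilbertRepSchurGraph` (von Neumann's graph method
for a closable operator commuting with ONE topologically irreducible unitary representation:
it is a scalar). This file proves the two-space variant that drives the *closability route* to
Jacquet–Shalika's Kirillov bound (Jacquet–Shalika (1981), (3.16) Proposition, p. 542; in the
tree the named fact `Literature.NumberTheory.Automorphic.JacquetShalika1981_archKirillovNorm_le`):
the Kirillov map `A : v ↦ (h ↦ ℓ(τ(diag(h,1)) v))` from (smooth vectors of) a unitary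
representation of the mirabolic group `P` into the irreducible induced representation
`τ = Ind_N^P θ` on `L²(N \ P)` intertwines the two unitary actions of `P`; once it is known to
be *closable*, the lemma below says it is *bounded*, `‖A v‖ ≤ C ‖v‖`, which is the printed
inequality `∫_{N\P} |W|²(p) d_r p ≤ c ‖W‖²`.

* `ContRepresentation.exists_norm_snd_le_of_invariant_of_schur` — let `σ`, `ρ` be unitary
  representations of a group `G` on complex Hilbert spaces `E`, `L`, where `ρ` has the **Schur
  property** (every bounded operator commuting with all `ρ g` is a scalar), and let `Γ ≤ E × L`
  be a complex linear relation which is `G`-invariant (`(x, y) ∈ Γ ⇒ (σ g x, ρ g y) ∈ Γ`) and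
  whose closure is a graph (`(0, y) ∈ closure Γ ⇒ y = 0`, i.e. `Γ` is the graph of a *closable*
  intertwining operator on its domain, which need not be dense or closed). Then `Γ` is the graph
  of a **bounded** operator: `‖y‖ ≤ C ‖x‖` for all `(x, y) ∈ Γ`.
* `ContRepresentation.IsTopIrreducible.exists_norm_snd_le_of_invariant` — the same with the
  Schur property supplied by Schur's lemma for a topologically irreducible unitary `ρ`
  (`HilbertRepSchur`).

Proof (the graph method of `HilbertRepSchurGraph`, Wallach (1988), 1.2.2; Knapp–Vogan (1995),
Notes to the Introduction, run in `E ⊕₂ L`): the closure `K` of `Γ` in the Hilbert sum and its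
orthogonal complement are invariant under the unitaries `σ g ⊕ ρ g`, so the orthogonal
projection `P` onto `K` commutes with them; its corner `D f = (P(0, f))₂` is a bounded operator
on `L` commuting with `ρ`, hence a scalar `d` (Schur property), and its corner `B u = (P(u, 0))₂`
is bounded `E → L`. For `(x, y) ∈ Γ`, `P(x, y) = (x, y)` gives `y = B x + d y`, i.e.
`(1 - d) y = B x`. If `d ≠ 1` this is the bound with `C = ‖B‖ / |1 - d|`. If `d = 1`, then for
every `f ∈ L` the vector `P(0, f) = ((P(0,f))₁, f)` has norm at most `‖f‖`, forcing
`(P(0, f))₁ = 0`, so `(0, f)` lies in the closure of `Γ`, whence `f = 0`: `L = 0` and the bound is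
trivial. No density of the domain, no irreducibility of `σ` and no adjoint of an unbounded
operator is used. Everything here is proved; no definitions.

## References

* N. R. Wallach, *Real Reductive Groups I*, Academic Press (1988), 1.2.2 [WallachRRG1].
* A. W. Knapp, D. A. Vogan, *Cohomological Induction and Unitary Representations*, Princeton
  (1995), Introduction, Thm. 0.2 and Notes [KnappVogan1995].
* H. Jacquet, J. A. Shalika, *On Euler products and the classification of automorphic
  representations I*, Amer. J. Math. 103 (1981), 499–558, (3.16) p. 542 and p. 506
  [JacquetShalikaAJM1981].
-/

noncomputable section

open scoped InnerProductSpace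
open Topology

namespace ContRepresentation

section GraphTwo

variable {G E L : Type*} [Group G]
  [NormedAddCommGroup E] [InnerProductSpace ℂ E] [CompleteSpace E]
  [NormedAddCommGroup L] [InnerProductSpace ℂ L] [CompleteSpace L]
  {σ : ContRepresentation ℂ G E} {ρ : ContRepresentation ℂ G L}

/-- **Schur's lemma for closable intertwiners into a representation with the Schur property.**
Let `σ`, `ρ` be unitary representations of `G` on the complex Hilbert spaces `E`, `L`, and assume
every bounded operator on `L` commuting with all `ρ g` is a scalar. Let `Γ ≤ E × L` be a complex
subspace with `(σ g x, ρ g y) ∈ Γ` whenever `(x, y) ∈ Γ`, whose closure contains no `(0, y)` with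
`y ≠ 0`. Then there is `C ≥ 0` with `‖y‖ ≤ C ‖x‖` for all `(x, y) ∈ Γ` (a closable intertwiner,
defined on an invariant — not necessarily dense — subspace, into a representation with the Schur
property is bounded; the graph method of Wallach (1988), 1.2.2, in `E ⊕₂ L`).
[cite: WallachRRG1, 1.2.2] [cite: KnappVogan1995, Introduction, Thm. 0.2 and Notes] -/
theorem exists_norm_snd_le_of_invariant_of_schur (hσ : σ.IsUnitary) (hρ : ρ.IsUnitary)
    (hSchur : ∀ T : L →L[ℂ] L, (∀ g : G, Commute (ρ g : L →L[ℂ] L) T) → ∃ c : ℂ, ∀ f : L, T f = c • f)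
    (Γ : Submodule ℂ (E × L))
    (hinv : ∀ g : G, ∀ x ∈ Γ, (σ g x.1, ρ g x.2) ∈ Γ)
    (hgraph : ∀ y : L, ((0 : E), y) ∈ Γ.topologicalClosure → y = 0) :
    ∃ C : ℝ, 0 ≤ C ∧ ∀ x ∈ Γ, ‖x.2‖ ≤ C * ‖x.1‖ := by
  classical
  -- the Hilbert sum `E ⊕₂ L` and the transport `e : WithLp 2 (E × L) ≃L E × L`
  set e : WithLp 2 (E × L) ≃L[ℂ] E × L := WithLp.prodContinuousLinearEquiv 2 ℂ E L with he
  have he_apply : ∀ z : WithLp 2 (E × L), e z = WithLp.ofLp z := fun z ↦ rfl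
  have he_symm : ∀ x : E × L, e.symm x = WithLp.toLp 2 x := fun x ↦ rfl
  -- norms in `E ⊕₂ L`
  have hnorm_sq : ∀ x : E × L, ‖e.symm x‖ ^ 2 = ‖x.1‖ ^ 2 + ‖x.2‖ ^ 2 := by
    intro x
    rw [he_symm, WithLp.prod_norm_sq_eq_of_L2]
    rfl
  -- the closure `K` of `Γ` inside `E ⊕₂ L`
  set Γ' : Submodule ℂ (WithLp 2 (E × L)) := Γ.map (e.symm : E × L →ₗ[ℂ] WithLp 2 (E × L))
    with hΓ'
  set K : Submodule ℂ (WithLp 2 (E × L)) := Γ'.topologicalClosure with hK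
  have hKclosed : IsClosed (K : Set (WithLp 2 (E × L))) := Γ'.isClosed_topologicalClosure
  haveI : CompleteSpace K := hKclosed.completeSpace_coe
  have hΓ'_coe : (Γ' : Set (WithLp 2 (E × L))) = e.symm '' (Γ : Set (E × L)) := by
    rw [hΓ']; exact Submodule.map_coe _ _
  have hK_coe : (K : Set (WithLp 2 (E × L))) = e.symm '' (Γ.topologicalClosure : Set (E × L)) := by
    rw [hK, Submodule.topologicalClosure_coe, hΓ'_coe, Submodule.topologicalClosure_coe]
    exact (e.symm.toHomeomorph.image_closure (Γ : Set (E × L))).symm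
  have hmemK : ∀ z : WithLp 2 (E × L), z ∈ K ↔ e z ∈ Γ.topologicalClosure := by
    intro z
    rw [← SetLike.mem_coe, hK_coe]
    constructor
    · rintro ⟨x, hx, rfl⟩
      rw [ContinuousLinearEquiv.apply_symm_apply]
      exact hx
    · intro hz
      exact ⟨e z, hz, by simp⟩
  have hmemK' : ∀ x : E × L, e.symm x ∈ K ↔ x ∈ Γ.topologicalClosure := by
    intro x
    rw [hmemK, ContinuousLinearEquiv.apply_symm_apply]
  have hΓle : Γ ≤ Γ.topologicalClosure := Γ.le_topologicalClosure
  have hmemK_of_mem : ∀ x ∈ Γ, e.symm x ∈ K := fun x hx ↦ (hmemK' x).2 (hΓle hx)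
  -- the unitary operators `U g = σ g ⊕ ρ g` on `E ⊕₂ L`
  set U : G → WithLp 2 (E × L) →L[ℂ] WithLp 2 (E × L) := fun g ↦
    (e.symm : E × L →L[ℂ] WithLp 2 (E × L)) ∘L ((σ g).prodMap (ρ g)) ∘L
      (e : WithLp 2 (E × L) →L[ℂ] E × L) with hU
  have hU_apply : ∀ (g : G) (z : WithLp 2 (E × L)),
      U g z = e.symm (σ g (e z).1, ρ g (e z).2) := fun g z ↦ rfl
  have hU_symm : ∀ (g : G) (x : E × L), U g (e.symm x) = e.symm (σ g x.1, ρ g x.2) := by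
    intro g x
    rw [hU_apply, ContinuousLinearEquiv.apply_symm_apply]
  -- `U g` preserves `Γ'`, `K` and `Kᗮ`
  have hUΓ' : ∀ g, ∀ z ∈ Γ', U g z ∈ Γ' := by
    intro g z hz
    rw [hΓ', Submodule.mem_map] at hz ⊢
    obtain ⟨x, hx, rfl⟩ := hz
    exact ⟨(σ g x.1, ρ g x.2), hinv g x hx, (hU_symm g x).symm⟩
  have hUK : ∀ g, ∀ z ∈ K, U g z ∈ K := by
    intro g z hz
    have hsub : (U g) '' closure (Γ' : Set (WithLp 2 (E × L))) ⊆
        closure ((U g) '' (Γ' : Set (WithLp 2 (E × L)))) :=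
      image_closure_subset_closure_image (U g).continuous
    have hz' : U g z ∈ closure ((U g) '' (Γ' : Set (WithLp 2 (E × L)))) :=
      hsub ⟨z, by rwa [← Submodule.topologicalClosure_coe], rfl⟩
    rw [← SetLike.mem_coe, hK, Submodule.topologicalClosure_coe]
    refine closure_mono ?_ hz'
    rintro _ ⟨w, hw, rfl⟩
    exact hUΓ' g w hw
  have hinnerU : ∀ (g : G) (z w : WithLp 2 (E × L)), ⟪U g z, w⟫_ℂ = ⟪z, U g⁻¹ w⟫_ℂ := by
    intro g z w
    rw [hU_apply g z, hU_apply g⁻¹ w, he_symm, he_symm, WithLp.prod_inner_apply,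
      WithLp.prod_inner_apply]
    simp only [hσ.inner_map_left, hρ.inner_map_left]
    rfl
  have hUKperp : ∀ g, ∀ z ∈ Kᗮ, U g z ∈ Kᗮ := by
    intro g z hz
    rw [Submodule.mem_orthogonal'] at hz ⊢
    intro w hw
    rw [hinnerU]
    exact hz _ (hUK g⁻¹ w hw)
  -- the projection onto `K` commutes with `U g`
  set P := K.starProjection with hP
  have hPU : ∀ (g : G) (z : WithLp 2 (E × L)), P (U g z) = U g (P z) := by
    intro g z
    refine Submodule.eq_starProjection_of_mem_orthogonal' (hUK g _ (K.starProjection_apply_mem z))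
      (hUKperp g _ (K.sub_starProjection_mem_orthogonal z)) ?_
    rw [← map_add, add_sub_cancel]
  have heU : ∀ (g : G) (z : WithLp 2 (E × L)), e (U g z) = (σ g (e z).1, ρ g (e z).2) := by
    intro g z
    rw [hU_apply, ContinuousLinearEquiv.apply_symm_apply]
  -- the corners `B u = (P(u,0))₂ : E → L` and `D f = (P(0,f))₂ : L → L`
  set B : E →L[ℂ] L := (ContinuousLinearMap.snd ℂ E L) ∘L (e : WithLp 2 (E × L) →L[ℂ] E × L) ∘L
    P ∘L (e.symm : E × L →L[ℂ] WithLp 2 (E × L)) ∘L (ContinuousLinearMap.inl ℂ E L) with hB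
  set D : L →L[ℂ] L := (ContinuousLinearMap.snd ℂ E L) ∘L (e : WithLp 2 (E × L) →L[ℂ] E × L) ∘L
    P ∘L (e.symm : E × L →L[ℂ] WithLp 2 (E × L)) ∘L (ContinuousLinearMap.inr ℂ E L) with hD
  have hB_apply : ∀ u, B u = (e (P (e.symm (u, 0)))).2 := fun u ↦ rfl
  have hD_apply : ∀ f, D f = (e (P (e.symm (0, f)))).2 := fun f ↦ rfl
  -- `D` commutes with `ρ`, hence is a scalar `d`
  have hcommD : ∀ g : G, Commute (ρ g) D := by
    intro g
    refine ContinuousLinearMap.ext fun f ↦ ?_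
    change ρ g (D f) = D (ρ g f)
    rw [hD_apply, hD_apply]
    have h1 : e.symm (0, ρ g f) = U g (e.symm (0, f)) := by
      rw [hU_symm]; simp
    rw [h1, hPU, heU]
  obtain ⟨d, hd⟩ := hSchur D hcommD
  -- the second component of `P(x) = x` for `x ∈ Γ`: `x.2 = B x.1 + d • x.2`
  have hdecomp : ∀ x ∈ Γ, x.2 = B x.1 + d • x.2 := by
    intro x hx
    have hPx : P (e.symm x) = e.symm x := (Submodule.starProjection_eq_self_iff).2 (hmemK_of_mem x hx)
    have hsplit : e.symm x = e.symm (x.1, 0) + e.symm (0, x.2) := by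
      rw [← map_add, Prod.mk_add_mk, add_zero, zero_add]
    have h2 : (e (P (e.symm x))).2 = x.2 := by
      rw [hPx, ContinuousLinearEquiv.apply_symm_apply]
    rw [← hd x.2, hD_apply, hB_apply, ← Prod.snd_add, ← map_add, ← map_add, ← hsplit]
    exact h2.symm
  by_cases hd1 : d = 1
  · -- `d = 1`: `L = 0`, the bound is trivial
    have hL : ∀ f : L, f = 0 := by
      intro f
      -- `w = P(0,f)` has `‖w‖ ≤ ‖f‖` and second component `f`, so its first component vanishes
      set w := P (e.symm (0, f)) with hw
      have hw2 : (e w).2 = f := by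
        have := hd f
        rw [hd1, one_smul, hD_apply] at this
        exact this
      have hwle : ‖w‖ ≤ ‖f‖ := by
        calc ‖w‖ ≤ ‖e.symm ((0 : E), f)‖ := K.norm_starProjection_apply_le _
          _ = ‖f‖ := by
            have h := hnorm_sq ((0 : E), f)
            simp only [norm_zero, ne_eq, OfNat.ofNat_ne_zero, not_false_eq_true, zero_pow,
              zero_add] at h
            exact (sq_eq_sq₀ (norm_nonneg _) (norm_nonneg _)).1 h
      have hw1 : (e w).1 = 0 := by
        have hsq : ‖w‖ ^ 2 = ‖(e w).1‖ ^ 2 + ‖(e w).2‖ ^ 2 := by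
          have h := hnorm_sq (e w)
          rwa [ContinuousLinearEquiv.symm_apply_apply] at h
        rw [hw2] at hsq
        have hle : ‖w‖ ^ 2 ≤ ‖f‖ ^ 2 := pow_le_pow_left₀ (norm_nonneg _) hwle 2
        have h0 : ‖(e w).1‖ ^ 2 ≤ 0 := by linarith
        have h0' : ‖(e w).1‖ ^ 2 = 0 := le_antisymm h0 (sq_nonneg _)
        exact norm_eq_zero.1 (pow_eq_zero_iff two_ne_zero |>.1 h0')
      have hew : e w = ((0 : E), f) := Prod.ext hw1 hw2
      have hmem : ((0 : E), f) ∈ Γ.topologicalClosure := by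
        rw [← hew, ← hmemK]
        exact K.starProjection_apply_mem _
      exact hgraph f hmem
    refine ⟨0, le_rfl, fun x _ ↦ ?_⟩
    rw [hL x.2, norm_zero, zero_mul]
  · -- `d ≠ 1`: `x.2 = (1 - d)⁻¹ • B x.1`
    have h1d : (1 - d : ℂ) ≠ 0 := sub_ne_zero.2 (Ne.symm hd1)
    refine ⟨‖(1 - d : ℂ)⁻¹‖ * ‖B‖, by positivity, fun x hx ↦ ?_⟩
    have hx2 : x.2 = (1 - d : ℂ)⁻¹ • B x.1 := by
      have h := hdecomp x hx
      have h' : (1 - d : ℂ) • x.2 = B x.1 := by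
        rw [sub_smul, one_smul]
        exact sub_eq_of_eq_add h
      rw [← h', smul_smul, inv_mul_cancel₀ h1d, one_smul]
    calc ‖x.2‖ = ‖(1 - d : ℂ)⁻¹ • B x.1‖ := by rw [← hx2]
      _ = ‖(1 - d : ℂ)⁻¹‖ * ‖B x.1‖ := norm_smul _ _
      _ ≤ ‖(1 - d : ℂ)⁻¹‖ * (‖B‖ * ‖x.1‖) := by
          gcongr
          exact B.le_opNorm x.1
      _ = ‖(1 - d : ℂ)⁻¹‖ * ‖B‖ * ‖x.1‖ := by ring

/-- **Schur's lemma for closable intertwiners into an irreducible unitary representation**: as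
`exists_norm_snd_le_of_invariant_of_schur`, with the Schur property of `ρ` supplied by Schur's
lemma for the topologically irreducible unitary `ρ` (`HilbertRepSchur`): a closable intertwiner
from a unitary representation into an IRREDUCIBLE unitary representation, defined on an invariant
subspace, is bounded. [cite: WallachRRG1, 1.2.2] [cite: KnappVogan1995, Introduction, Thm. 0.2 and Notes] -/
theorem IsTopIrreducible.exists_norm_snd_le_of_invariant (hirr : ρ.IsTopIrreducible)
    (hσ : σ.IsUnitary) (hρ : ρ.IsUnitary) (Γ : Submodule ℂ (E × L))
    (hinv : ∀ g : G, ∀ x ∈ Γ, (σ g x.1, ρ g x.2) ∈ Γ)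
    (hgraph : ∀ y : L, ((0 : E), y) ∈ Γ.topologicalClosure → y = 0) :
    ∃ C : ℝ, 0 ≤ C ∧ ∀ x ∈ Γ, ‖x.2‖ ≤ C * ‖x.1‖ :=
  exists_norm_snd_le_of_invariant_of_schur hσ hρ
    (fun _ hT ↦ hirr.exists_apply_eq_smul_of_commute hρ hT) Γ hinv hgraph

end GraphTwo

end ContRepresentation
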